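import Summits.QuantumFields.YangMills.Theorems.BalabanUVNodesK2Line1PrimeRemainderPrice
import Summits.QuantumFields.YangMills.Theses.BalabanUVNodes
import Literature.MathematicalPhysics.QuantumFieldTheory.Balaban1983to89.Node00.Record8Chart

/-!
# CRIT-1 g2 (cell ym-nodeO-ideate) — FOLLOW-THROUGH on K2⁷ LINE 1′ «named jets» (skeleton v3 `D80-K2V3/K2Skeleton13SepCoPHv3.lean` bdd723a03d543770,
  :172–:191; the same quantifier shape in b2b-an4's constant-form pair `RemAtCSomeJets` ∕ `D1AtShadowingJetsC`, p590583)

FINDING (kernel-checked below, no `sorry`): the registered pair of stubs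
  `stub_remNamedJets13 : RemAtSomeJets := ∀ F, ∃ κ, ∀ θ (hP : θ.Provisos₁₃SepCoPH F 2), θ.Admissible F 2 → RemAt F κ θ hP`
  `stub_d1NamedJets13 : D1AtShadowingJets := ∀ F κ θ hP, θ.Admissible F 2 → RemAt F κ θ hP → ∃ A, OneLoopDrift (stepBal 2 F.L) A (beta0OfJs F κ)`
is JOINTLY FALSE modulo `TwoNormalisations` (§3): the existence, in ONE family `F`, of two proviso-carrying admissible Stage-13 tuples whose β-functions of
record are PROPORTIONAL with a factor `λ ≠ 1` on some common box of histories.  Mechanism: a box remainder (indeed its per-scale ANCHOR, an4's weakest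
form) PINS the reference numbers to the record's small-coupling germ (`eq_of_anchors`); ONE κ serving BOTH tuples pins `beta0OfJs F κ` to `b` AND to `λ b`,
so `b = 0` (§2), and then stub 1′ asks the ZERO sequence to drift with the positive slope `stepBal 2 F.L` — absurd (§2 `not_oneLoopDrift_zero`).

WHY `TwoNormalisations` is the generic situation, not a pathology (§1): the record's β reads the β-chart `(Vβ, ρ8, bV)` through `polScalar`, whose summands
`polComp ℝ 𝓔 bV … a … a` are BILINEAR in the basis vectors (`polTensor_smul_left ∕ _right`): rescaling the basis `bV ↦ u•bV` multiplies every finite-volume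
kernel by `u²` (`polScalar_unitsSMul`), while the chart clause of record `IsSuChart N ρ b c` is PRESERVED with `c ↦ u²·c` (`isSuChart_unitsSMul`) and Stage-9
admissibility asks only `0 < cβ ∧ IsChartOfRecord cβ` — the normalisation `cβ ∈ ]0, ∞[` is FREE inside the admissible class (the tree itself displays
`c = 1`, `ChartOfRecord.isChartOfRecord_rechart`, and `c = 2`, `Record8Chart.isChartOfRecord_rechartPauli`, at `N = 2`).  Neither `Provisos₁₃SepCoPH` nor
`ZhUnity ∧ SlotsNondegenerate₁₃` mentions `cβ`, `ρ8` or `bV` except through the generated flow.  (The exact identity `β_{θ'} = u²·β_θ` holds wherever the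
(1.21) `limUnder`s are limits — [I] Thm 3's content —; at junk values of `limUnder` nothing is claimed, which is why the hypothesis is stated on β directly.)

CLASS: stub-misstated (normalisation slot dropped from the identification «record's one-loop numbers = named numbers»; κ quantified BEFORE θ).
NOTE: moving `∃ κ` under `∀ θ` ALONE does not repair it — stub 1′'s slope `stepBal 2 F.L` is itself normalisation-specific (`c·b` drifts with slope
`c·stepBal`).  REPAIRED LETTER (§4, composition kernel-checked): carry the tuple's chart constant — shadow `β_θ` by `θ.cβ • beta0OfJs F κ` with the seam
`C_r γ₀ ≤ θ.cβ · stepBal 2 F.L`; stub 1′ unchanged; the END runs at slope `θ.cβ · stepBal 2 F.L` (`oneLoopDrift_const_mul`).  The two-normalisation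
witness MISSES the repaired pair (one κ serves `θ` and its rescaling).

HONEST FRAMING: nothing here proves or refutes an estimate of Bałaban's; K2⁷ (stmt-QuantumFields-20543) stays OPEN; the Clay YM mass gap is NOT proved by
any of this; R4 closes only the conditional finite-𝕋⁴ rung `BalabanLadder.UV`.
-/

namespace YMNodeOIdeate.Crit1.NamedJetsNormalisation

open Finset
open scoped BigOperators
open Literature.MathematicalPhysics.QuantumFieldTheory.Balaban1983to89
open Literature.MathematicalPhysics.QuantumFieldTheory.Balaban1983to89.FlowStep
open Literature.MathematicalPhysics.QuantumFieldTheory.Balaban1983to89.DagBinding (EndpointExistence ForwardGenerated)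
open Literature.MathematicalPhysics.QuantumFieldTheory.Balaban1983to89.T4Continuum (T4Family)
open Literature.MathematicalPhysics.QuantumFieldTheory.Balaban1983to89.B12Beta (HistBox)
open Literature.MathematicalPhysics.QuantumFieldTheory.Balaban1983to89.Node00
open Literature.MathematicalPhysics.QuantumFieldTheory.Balaban1983to89.Beta.Drift (OneLoopDrift)
open Summit.QuantumFields.YangMills.Theorems.BalabanUVNodesK2JsOfRecord
  (StepColourData JsOfRecord beta0OfJs BoxRemainder endpointExistence_of_drift_boxRemainder boxRemainder_unique)
open Summit.QuantumFields.YangMills.Theorems.BalabanUVNodesK2Line1PrimeRemainderPrice (eq_of_anchors anchor_of_boxRemainder)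

/-! ## §1 The chart clause of record does not pin the normalisation; the polarisation components are bilinear in the basis -/

section Chart

open Literature.Algebra.Lie.CompactKillingForm (hsForm hsForm_apply)
open Literature.MathematicalPhysics.QuantumFieldTheory.Balaban1983to89.B12PolarizationTensor120 (polTensor polComp polTensor_smul_left polTensor_smul_right)
open Matrix

/-- Rescaling an `IsSuChart`-basis by a unit `u` gives an `IsSuChart`-basis with constant `u²·c`: the chart clause of record is closed under
normalisation changes, so Stage-9 admissibility (`0 < cβ ∧ IsChartOfRecord cβ`) leaves `cβ ∈ ]0,∞[` free. [cite: Balaban1987RG1, (1.20)–(1.21) p.264 (bookkeeping)] -/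
theorem isSuChart_unitsSMul {N : ℕ} {V : Type*} [NormedAddCommGroup V] [NormedSpace ℝ V] {ι : Type*}
    {ρ : V →L[ℝ] Matrix (Fin N) (Fin N) ℂ} {b : Module.Basis ι ℝ V} {c : ℝ} (h : IsSuChart N ρ b c) (u : ℝˣ) :
    IsSuChart N ρ (b.unitsSMul fun _ => u) ((u : ℝ) ^ 2 * c) := by
  obtain ⟨h1, h2, h3, h4⟩ := h
  have hscale : ∀ a a' : ι, hsForm (Fin N) (ρ (b.unitsSMul (fun _ => u) a)) (ρ (b.unitsSMul (fun _ => u) a')) =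
      (u : ℝ) ^ 2 * hsForm (Fin N) (ρ (b a)) (ρ (b a')) := by
    intro a a'
    simp only [Module.Basis.unitsSMul_apply, Units.smul_def, map_smul, LinearMap.smul_apply, smul_eq_mul]
    ring
  refine ⟨h1, h2, fun a => ?_, fun a a' haa => ?_⟩
  · rw [hscale, h3]
  · rw [hscale, h4 a a' haa, mul_zero]

/-- The polarisation components in a rescaled basis: `Π^{ab}[u•bV] = u²·Π^{ab}[bV]` (bilinearity of (1.20) in the colour directions).
[cite: Balaban1987RG1, (1.20) p.264 (bookkeeping)] -/
theorem polComp_unitsSMul {Λ T V F : Type*} [Fintype Λ] [Fintype T] [DecidableEq Λ] [DecidableEq T] [NormedAddCommGroup V] [NormedSpace ℝ V]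
    [NormedAddCommGroup F] [NormedSpace ℝ F] {ι : Type*} (𝓔 : (Λ → T → V) → F) (bV : Module.Basis ι ℝ V) (u : ℝˣ)
    (μ : Λ) (x : T) (a : ι) (ν : Λ) (y : T) (a' : ι) :
    polComp ℝ 𝓔 (bV.unitsSMul fun _ => u) μ x a ν y a' = ((u : ℝ) * u) • polComp ℝ 𝓔 bV μ x a ν y a' := by
  unfold polComp
  rw [Module.Basis.unitsSMul_apply, Module.Basis.unitsSMul_apply, Units.smul_def, Units.smul_def, polTensor_smul_left,
    polTensor_smul_right, smul_smul]

/-- The record's scalar kernel (`polScalar`, the normalised trace of the diagonal components) in a rescaled basis is `u²` times the original: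
the β-functions of record are homogeneous of degree one in the chart normalisation `cβ` at every finite volume. [cite: Balaban1987RG1, (1.20)–(1.22) p.264 (bookkeeping)] -/
theorem polScalar_unitsSMul {Λ T V 𝔄 : Type*} [Fintype Λ] [Fintype T] [DecidableEq Λ] [DecidableEq T] [NormedAddCommGroup V] [NormedSpace ℝ V]
    [NormedRing 𝔄] [NormedAlgebra ℝ 𝔄] [CompleteSpace 𝔄] {ι : Type*} [Fintype ι]
    (ℰ : (Λ → T → 𝔄) → ℝ) (ρ : V →L[ℝ] 𝔄) (bV : Module.Basis ι ℝ V) (u : ℝˣ) (μ : Λ) (x : T) (ν : Λ) (y : T) :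
    polScalar ℰ ρ (bV.unitsSMul fun _ => u) μ x ν y = ((u : ℝ) * u) * polScalar ℰ ρ bV μ x ν y := by
  unfold polScalar
  simp_rw [polComp_unitsSMul, smul_eq_mul]
  rw [← Finset.mul_sum]
  ring

end Chart

/-! ## §2 Pure logic: two anchors of PROPORTIONAL β's at the SAME reference sequence force it to vanish; the zero sequence does not drift -/

section Logic

variable {β β' : HBeta} {b : ℕ → ℝ}

/-- The per-scale anchor shape (an4 p590583 `eq_of_anchors`' hypothesis; DEF-1's `BoxRemainder` implies it, `anchor_of_boxRemainder`). [folklore] -/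
def Anchor (β : HBeta) (b : ℕ → ℝ) : Prop :=
  ∀ (k : ℕ) (δ : ℝ), 0 < δ → ∃ γ : ℝ, 0 < γ ∧ ∀ p : Fin (k + 1) → ℝ, p ∈ HistBox γ k → |β k p - b k| ≤ δ

/-- An anchor of `β` at `b` is an anchor of `λ•β` at `λ•b`; if `β' = λβ` on a common box, it is an anchor of `β'`. [folklore] -/
theorem anchor_of_proportional {lam γ₁ : ℝ} (hγ₁ : 0 < γ₁)
    (hprop : ∀ (k : ℕ) (p : Fin (k + 1) → ℝ), p ∈ HistBox γ₁ k → β' k p = lam * β k p) (h : Anchor β b) :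
    Anchor β' (fun k => lam * b k) := by
  intro k δ hδ
  obtain ⟨γ, hγ, hb⟩ := h k (δ / (|lam| + 1)) (by positivity)
  refine ⟨min γ γ₁, lt_min hγ hγ₁, fun p hp => ?_⟩
  have hpγ : p ∈ HistBox γ k := fun i => ⟨(hp i).1, (hp i).2.trans (min_le_left _ _)⟩
  have hpγ₁ : p ∈ HistBox γ₁ k := fun i => ⟨(hp i).1, (hp i).2.trans (min_le_right _ _)⟩
  rw [hprop k p hpγ₁, ← mul_sub, abs_mul]
  have h1 := hb p hpγ
  have hlam : 0 ≤ |lam| := abs_nonneg _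
  calc |lam| * |β k p - b k| ≤ |lam| * (δ / (|lam| + 1)) := mul_le_mul_of_nonneg_left h1 hlam
    _ ≤ (|lam| + 1) * (δ / (|lam| + 1)) := mul_le_mul_of_nonneg_right (by linarith) (by positivity)
    _ = δ := by field_simp

/-- **★ TWO TUPLES WITH PROPORTIONAL β (factor `λ ≠ 1`) CANNOT SHARE ANCHORED REFERENCE NUMBERS UNLESS THESE VANISH**: anchors of `β` and of `β' = λβ`
(on a common box) at the SAME `b` force `b = 0`. [folklore] -/
theorem eq_zero_of_anchors_proportional {lam γ₁ : ℝ} (hlam : lam ≠ 1) (hγ₁ : 0 < γ₁)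
    (hprop : ∀ (k : ℕ) (p : Fin (k + 1) → ℝ), p ∈ HistBox γ₁ k → β' k p = lam * β k p)
    (h : Anchor β b) (h' : Anchor β' b) : b = 0 := by
  have hlamb : (fun k => lam * b k) = b := eq_of_anchors (anchor_of_proportional hγ₁ hprop h) h'
  funext k
  have hk : lam * b k = b k := congrFun hlamb k
  have : (lam - 1) * b k = 0 := by linarith
  rcases mul_eq_zero.mp this with h0 | h0
  · exact absurd (sub_eq_zero.mp h0) hlam
  · exact h0

/-- The ZERO sequence does not drift with a positive slope (Archimedes). [folklore] -/
theorem not_oneLoopDrift_zero {s : ℝ} (hs : 0 < s) (A : ℝ) : ¬ OneLoopDrift s A 0 := by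
  intro h
  obtain ⟨n, hn⟩ := exists_nat_gt (A / s)
  have hk := h n
  simp only [Pi.zero_apply, Finset.sum_const_zero, zero_sub, abs_neg] at hk
  rw [abs_of_nonneg (by positivity)] at hk
  have : A < s * n := by rwa [div_lt_iff₀ hs, mul_comm] at hn
  linarith

/-- A drift survives multiplication by ANY constant: `c•b` drifts with slope `c·s` up to `|c|·A` (the repaired composition's only new step). [folklore] -/
theorem oneLoopDrift_const_mul {s A : ℝ} (h : OneLoopDrift s A b) (c : ℝ) : OneLoopDrift (c * s) (|c| * A) (fun k => c * b k) := by
  intro k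
  rw [← Finset.mul_sum, mul_assoc, ← mul_sub, abs_mul]
  exact mul_le_mul_of_nonneg_left (h k) (abs_nonneg c)

end Logic

/-! ## §3 The hypothesis and the kill of the REGISTERED pair (v3 texts VERBATIM) and of an4's constant-form pair -/

section Kill

/-- **HYPOTHESIS `TwoNormalisations`** (a precise `Prop`, NOT constructed here — it needs a proviso-carrying admissible Stage-13 tuple, i.e. K0⁷-type
inhabitation, at two chart normalisations with the (1.21) limits existing): in some family, two proviso-carrying admissible Stage-13 tuples whose
β-functions of record are proportional with a factor `λ ≠ 1` on a common box `]0, γ₁]`.  §1 is why a basis rescaling `bV ↦ u•bV`, `cβ ↦ u²cβ`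
(`u² ≠ 1`) produces it. [cite: Balaban1987RG1, (1.20)–(1.22) p.264 (bookkeeping)] -/
def TwoNormalisations : Prop :=
  ∃ (F : T4Family) (θ θ' : Node00.Stage13HParams F 2) (hP : θ.Provisos₁₃SepCoPH F 2) (hP' : θ'.Provisos₁₃SepCoPH F 2),
    θ.Admissible F 2 ∧ θ'.Admissible F 2 ∧ ∃ lam γ₁ : ℝ, lam ≠ 1 ∧ 0 < γ₁ ∧
      ∀ (k : ℕ) (p : Fin (k + 1) → ℝ), p ∈ HistBox γ₁ k →
        (Node00.datumOfRecord₁₃SepCoPH F 2 θ' hP').βfun k p = lam * (Node00.datumOfRecord₁₃SepCoPH F 2 θ hP).βfun k p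

/-- v3 :172–:177 VERBATIM (the shared letter). -/
def RemAtV3 (F : T4Family) (κ : StepColourData) (θ : Node00.Stage13HParams F 2) (hP : θ.Provisos₁₃SepCoPH F 2) : Prop :=
  ∃ γ₀ Cr β' : ℝ, 0 < γ₀ ∧ γ₀ ≤ θ.γ ∧ 0 ≤ Cr ∧ 0 ≤ β' ∧
    BoxRemainder (Node00.datumOfRecord₁₃SepCoPH F 2 θ hP).βfun (beta0OfJs F κ) Cr γ₀ ∧
    Cr * γ₀ ≤ B12Normalization.stepBal 2 F.L ∧
    BetaContH γ₀ (Node00.datumOfRecord₁₃SepCoPH F 2 θ hP).βfun ∧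
    BetaUpperH β' γ₀ (Node00.datumOfRecord₁₃SepCoPH F 2 θ hP).βfun

/-- v3 :181–:183 VERBATIM (`stub_remNamedJets13`'s text). -/
def RemAtSomeJetsV3 : Prop :=
  ∀ F : T4Family, ∃ κ : StepColourData,
    ∀ (θ : Node00.Stage13HParams F 2) (hP : θ.Provisos₁₃SepCoPH F 2), θ.Admissible F 2 → RemAtV3 F κ θ hP

/-- v3 :189–:191 VERBATIM (`stub_d1NamedJets13`'s text). -/
def D1AtShadowingJetsV3 : Prop :=
  ∀ (F : T4Family) (κ : StepColourData) (θ : Node00.Stage13HParams F 2) (hP : θ.Provisos₁₃SepCoPH F 2), θ.Admissible F 2 →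
    RemAtV3 F κ θ hP → ∃ A : ℝ, OneLoopDrift (B12Normalization.stepBal 2 F.L) A (beta0OfJs F κ)

/-- **★ KILL OF THE REGISTERED PAIR MODULO `TwoNormalisations`**: `TwoNormalisations → ¬ (stub 2′ ∧ stub 1′)` at v3's verbatim texts. [folklore] -/
theorem line1Prime_false_of_twoNormalisations (H : TwoNormalisations) : ¬ (RemAtSomeJetsV3 ∧ D1AtShadowingJetsV3) := by
  rintro ⟨h₂, h₁⟩
  obtain ⟨F, θ, θ', hP, hP', hθ, hθ', lam, γ₁, hlam, hγ₁, hprop⟩ := H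
  obtain ⟨κ, hκ⟩ := h₂ F
  have hR : RemAtV3 F κ θ hP := hκ θ hP hθ
  have hR' : RemAtV3 F κ θ' hP' := hκ θ' hP' hθ'
  obtain ⟨A, hdrift⟩ := h₁ F κ θ hP hθ hR
  obtain ⟨γ₀, Cr, β', hγ₀, -, hCr, -, hrem, -, -, -⟩ := hR
  obtain ⟨γ₀', Cr', β'', hγ₀', -, hCr', -, hrem', -, -, -⟩ := hR'
  have hb : beta0OfJs F κ = 0 :=
    eq_zero_of_anchors_proportional hlam hγ₁ hprop (anchor_of_boxRemainder hrem hCr hγ₀) (anchor_of_boxRemainder hrem' hCr' hγ₀')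
  rw [hb] at hdrift
  exact not_oneLoopDrift_zero (B12Normalization.stepBal_pos two_pos (by exact_mod_cast F.hL.2)) A hdrift

/-- an4's CONSTANT-FORM letter `RemAtC` (p590583 `remAtC_of_remAt`'s conclusion VERBATIM) — the v4 candidate keeps `∃ κ ∀ θ`. -/
def RemAtCV4 (F : T4Family) (κ : StepColourData) (θ : Node00.Stage13HParams F 2) (hP : θ.Provisos₁₃SepCoPH F 2) : Prop :=
  ∃ γ₀ s β' : ℝ, 0 < γ₀ ∧ γ₀ ≤ θ.γ ∧ 0 ≤ s ∧ s ≤ B12Normalization.stepBal 2 F.L ∧ 0 ≤ β' ∧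
    (∀ (k : ℕ) (p : Fin (k + 1) → ℝ), p ∈ HistBox γ₀ k → |(Node00.datumOfRecord₁₃SepCoPH F 2 θ hP).βfun k p - beta0OfJs F κ k| ≤ s) ∧
    (∀ (k : ℕ) (δ : ℝ), 0 < δ → ∃ γ : ℝ, 0 < γ ∧ ∀ p : Fin (k + 1) → ℝ, p ∈ HistBox γ k →
      |(Node00.datumOfRecord₁₃SepCoPH F 2 θ hP).βfun k p - beta0OfJs F κ k| ≤ δ) ∧
    BetaContH γ₀ (Node00.datumOfRecord₁₃SepCoPH F 2 θ hP).βfun ∧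
    BetaUpperH β' γ₀ (Node00.datumOfRecord₁₃SepCoPH F 2 θ hP).βfun

/-- **The same kill at the constant-form pair** (`∀ F, ∃ κ, ∀ θ …, RemAtC` ∧ `∀ F κ θ …, RemAtC → drift`): the ANCHOR conjunct alone carries it. [folklore] -/
theorem line1DoublePrime_false_of_twoNormalisations (H : TwoNormalisations) :
    ¬ ((∀ F : T4Family, ∃ κ : StepColourData, ∀ (θ : Node00.Stage13HParams F 2) (hP : θ.Provisos₁₃SepCoPH F 2), θ.Admissible F 2 → RemAtCV4 F κ θ hP) ∧
       (∀ (F : T4Family) (κ : StepColourData) (θ : Node00.Stage13HParams F 2) (hP : θ.Provisos₁₃SepCoPH F 2), θ.Admissible F 2 →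
          RemAtCV4 F κ θ hP → ∃ A : ℝ, OneLoopDrift (B12Normalization.stepBal 2 F.L) A (beta0OfJs F κ))) := by
  rintro ⟨h₂, h₁⟩
  obtain ⟨F, θ, θ', hP, hP', hθ, hθ', lam, γ₁, hlam, hγ₁, hprop⟩ := H
  obtain ⟨κ, hκ⟩ := h₂ F
  have hR : RemAtCV4 F κ θ hP := hκ θ hP hθ
  have hR' : RemAtCV4 F κ θ' hP' := hκ θ' hP' hθ'
  obtain ⟨A, hdrift⟩ := h₁ F κ θ hP hθ hR
  obtain ⟨γ₀, s, β', -, -, -, -, -, -, hanc, -, -⟩ := hR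
  obtain ⟨γ₀', s', β'', -, -, -, -, -, -, hanc', -, -⟩ := hR'
  have hb : beta0OfJs F κ = 0 := eq_zero_of_anchors_proportional hlam hγ₁ hprop hanc hanc'
  rw [hb] at hdrift
  exact not_oneLoopDrift_zero (B12Normalization.stepBal_pos two_pos (by exact_mod_cast F.hL.2)) A hdrift

/-- MOVING `∃ κ` UNDER `∀ θ` ALONE IS NOT A REPAIR: with per-tuple data `κ, κ'` the anchors give `beta0OfJs F κ' = λ • beta0OfJs F κ`, and stub 1′ then asks BOTH
to drift with the SAME slope `stepBal 2 F.L` — so `(λ − 1)·stepBal = 0`, i.e. again absurd for `λ ≠ 1`.  Kernel form: two drifts of `b` and `λb` with one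
positive slope force `λ = 1` unless … — stated as the contrapositive on the slope. [folklore] -/
theorem lam_eq_one_of_drift_and_drift_mul {b : ℕ → ℝ} {s A A' lam : ℝ} (hs : 0 < s) (h : OneLoopDrift s A b)
    (h' : OneLoopDrift s A' (fun k => lam * b k)) : lam = 1 := by
  by_contra hne
  -- `λb` drifts with slope `λs` (`oneLoopDrift_const_mul`) and with slope `s` (h'): the partial sums stay near two lines of different slopes
  have h1 := oneLoopDrift_const_mul h lam
  have hgap : ∀ k : ℕ, |(lam * s - s) * k| ≤ |lam| * A + A' := fun k => by
    have e1 : |∑ j ∈ Finset.range k, lam * b j - lam * s * k| ≤ |lam| * A := h1 k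
    have e2 : |∑ j ∈ Finset.range k, lam * b j - s * k| ≤ A' := h' k
    have e := abs_sub (∑ j ∈ Finset.range k, lam * b j - s * k) (∑ j ∈ Finset.range k, lam * b j - lam * s * k)
    have heq : (lam * s - s) * (k : ℝ) =
        (∑ j ∈ Finset.range k, lam * b j - s * k) - (∑ j ∈ Finset.range k, lam * b j - lam * s * k) := by ring
    rw [heq]
    linarith
  have hls : lam * s - s ≠ 0 := by
    intro h0; apply hne; have : (lam - 1) * s = 0 := by linarith
    rcases mul_eq_zero.mp this with h | h
    · linarith
    · exact absurd h hs.ne'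
  have hpos : 0 < |lam * s - s| := abs_pos.mpr hls
  obtain ⟨n, hn⟩ := exists_nat_gt ((|lam| * A + A') / |lam * s - s|)
  have hk := hgap n
  rw [abs_mul, Nat.abs_cast] at hk
  have : |lam| * A + A' < n * |lam * s - s| := by rwa [div_lt_iff₀ hpos] at hn
  linarith

end Kill

/-! ## §4 The REPAIRED letter (normalisation carried) closes K2⁷'s text exactly as v3's composition does; the witness misses it -/

section Repair

/-- **REPAIRED LETTER `RemAtN`**: v3's `RemAt` with the tuple's chart constant CARRIED — the record's β is shadowed by `θ.cβ • beta0OfJs F κ` and the seam reads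
`C_r γ₀ ≤ θ.cβ · stepBal 2 F.L`.  (If the β sub-cell's stencil normalisation corresponds to an `IsSuChart` constant `c⋆ ≠ 1`, read `θ.cβ / c⋆`; the structural
point is that the letter must carry `θ.cβ`.) [folklore] -/
def RemAtN (F : T4Family) (κ : StepColourData) (θ : Node00.Stage13HParams F 2) (hP : θ.Provisos₁₃SepCoPH F 2) : Prop :=
  ∃ γ₀ Cr β' : ℝ, 0 < γ₀ ∧ γ₀ ≤ θ.γ ∧ 0 ≤ Cr ∧ 0 ≤ β' ∧
    BoxRemainder (Node00.datumOfRecord₁₃SepCoPH F 2 θ hP).βfun (fun k => θ.cβ * beta0OfJs F κ k) Cr γ₀ ∧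
    Cr * γ₀ ≤ θ.cβ * B12Normalization.stepBal 2 F.L ∧
    BetaContH γ₀ (Node00.datumOfRecord₁₃SepCoPH F 2 θ hP).βfun ∧
    BetaUpperH β' γ₀ (Node00.datumOfRecord₁₃SepCoPH F 2 θ hP).βfun

/-- REPAIRED stub 2′: κ AFTER θ, normalisation carried. [folklore] -/
def RemAtNEachJets : Prop :=
  ∀ (F : T4Family) (θ : Node00.Stage13HParams F 2) (hP : θ.Provisos₁₃SepCoPH F 2), θ.Admissible F 2 → ∃ κ : StepColourData, RemAtN F κ θ hP

/-- REPAIRED stub 1′ (= v3's, keyed on the repaired letter): the named numbers drift with slope `stepBal 2 F.L`. [folklore] -/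
def D1AtNShadowingJets : Prop :=
  ∀ (F : T4Family) (κ : StepColourData) (θ : Node00.Stage13HParams F 2) (hP : θ.Provisos₁₃SepCoPH F 2), θ.Admissible F 2 →
    RemAtN F κ θ hP → ∃ A : ℝ, OneLoopDrift (B12Normalization.stepBal 2 F.L) A (beta0OfJs F κ)

/-- **THE REPAIRED PAIR CLOSES K2⁷ BY NAME** (the route decl `EndpointGivenBR13SepCoPH`, unfolded): v3's composition with the drift rescaled by `θ.cβ`
(`oneLoopDrift_const_mul`) — the END lemma accepts any slope. [folklore] -/
theorem endpointGivenBR13SepCoPH_of_repairedPair (h₁ : D1AtNShadowingJets) (h₂ : RemAtNEachJets) :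
    Summit.QuantumFields.YangMills.Theses.BalabanUVNodes.EndpointGivenBR13SepCoPH := by
  intro F θ hP _hU hθ _hB _hwin
  obtain ⟨κ, hRem⟩ := h₂ F θ hP hθ
  obtain ⟨A, hdrift⟩ := h₁ F κ θ hP hθ hRem
  obtain ⟨γ₀, Cr, β', hγ₀, -, hCr, hβ', hrem, hγ, hcont, hup⟩ := hRem
  exact endpointExistence_of_drift_boxRemainder (Node00.datumOfRecord₁₃SepCoPH F 2 θ hP).fwd hγ₀ (oneLoopDrift_const_mul hdrift θ.cβ) hrem hCr hγ hβ' hcont hup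

end Repair

end YMNodeOIdeate.Crit1.NamedJetsNormalisation
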